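import Literature.NumberTheory.LFunctions.VinogradovZetaSumLemmas
import Literature.NumberTheory.LFunctions.VinogradovMeanValueStepA
import HarnessLib

/-!
# The Vinogradov–Korobov bound for the bilinear Weyl sum `∑_{x,y ≤ a} e(α₁xy + ⋯ + α_r x^r y^r)`
# in terms of Vinogradov's mean value `J_{k,r}(a)`

Topic `Literature/NumberTheory/LFunctions`.  Everything in this file is PROVED; no definitions, no named facts.

This is the combinatorial core of the proof of Theorem 6.2 of A. Ivić, *The Riemann Zeta-Function* (Wiley
1985), §6.3, pp. 121–122 (PDF pp. 121–122): for real coefficients `α₁, …, α_r`, an integer `a ≥ 1` and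
`k ≥ 1`, the double sum `U = |∑_{x ≤ a} ∑_{y ≤ a} e(α₁xy + ⋯ + α_r x^r y^r)|` satisfies

  `U^{4k²} ≤ a^{8k² − 4k} · J_{k,r}(a)² · ∏_{m=1}^{r} ∑_{|μ| ≤ k a^m} min(2ka^m + 1, 1/(2‖α_m μ‖))`

(`core_bound`), where `J_{k,r}(a) = VMV.J r k [1, a]` is the number of solutions of Vinogradov's system
(`VinogradovMeanValueCount.lean`) and `min(V, 1/(2‖x‖)) = Sieve.Vinogradov.geomBound V x`.  Ivić's display has
`A_m = 2ka^m` and `min(2A_m, ‖α_m μ_m‖⁻¹)` over `|μ_m| < A_m`; the version here (range `|μ| ≤ ka^m`, which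
contains all differences of power sums of `k`-tuples from `[1, a]`, and the sharper `1/(2‖·‖)` of Lemma 6.4)
is what the argument gives.  The steps, all for finite sums:

1. `U ≤ ∑_x |∑_y e(β(x)·ν(y))|`, `β(x)_m = α_m x^m`, `ν(y) = (y, …, y^r)`, and Hölder:
   `U^{2k} ≤ a^{2k−1} ∑_x |∑_y e(β(x)·ν(y))|^{2k}` (`Real.pow_sum_div_card_le_sum_pow`);
2. Ivić (6.14): `|∑_{y ∈ I} e(γ·ν(y))|^{2k} = ∑_{(y,y') ∈ I^k × I^k} e(γ·(s(y) − s(y')))`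
   (`norm_tp_pow_two_mul_eq`; `s` = `VMV.psv`), whence
   `∑_x |∑_y e(β(x)·ν(y))|^{2k} ≤ ∑_{(y,y')} W(s(y) − s(y'))`, `W(λ) = |∑_x e(∑_m α_m λ_m x^m)|`;
3. Hölder over the `a^{2k}` pairs and the fibre count `#{(y,y') : s(y) − s(y') = λ} = J_{k,r}(λ) ≤ J_{k,r}(a)`
   (Ivić (6.10), `VMV.Jc_le_J`): `(∑ W)^{2k} ≤ a^{2k(2k−1)} J_{k,r}(a) ∑_{λ ∈ Λ} W(λ)^{2k}`, `Λ = ∏_m [−ka^m, ka^m]`;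
4. (6.14) again and summing the geometric series in each `λ_m` (Lemma 6.4,
   `VinogradovZetaSum.norm_sum_e_mul_le_geomBound`):
   `∑_{λ ∈ Λ} W(λ)^{2k} ≤ ∑_{(x,x')} ∏_m min(2ka^m+1, 1/(2‖α_m μ_m‖)) ≤ J_{k,r}(a) ∏_m ∑_{|μ| ≤ ka^m} min(…)`,
   `μ = s(x) − s(x')`.

## References
* A. Ivić, *The Riemann Zeta-Function*, John Wiley & Sons 1985 (Dover 2003), §6.2 (6.10), (6.11), (6.14), (6.15);
  §6.3, proof of Theorem 6.2. [cite: Ivic1985, Theorem 6.2 (proof)]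
-/

noncomputable section

open Finset Real Complex
open scoped ComplexConjugate

namespace Literature.NumberTheory.LFunctions
namespace VinogradovZetaSum

open VdC (e)
open Sieve.Vinogradov (geomBound geomBound_nonneg geomBound_le)
open VMV (E tp nu psv tuples Jc J)

variable {r : ℕ}

/-! ### Ivić (6.14): the `2k`-th power of a Weyl sum as a sum over pairs of `k`-tuples -/

/-- **Ivić (6.14)**: `|∑_{y ∈ I} e(γ·ν(y))|^{2k} = ∑_{(y,y') ∈ I^k × I^k} e(γ·(s(y) − s(y')))` (as a complex
number). [cite: Ivic1985, (6.14)] -/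
theorem norm_tp_pow_two_mul_eq (I : Finset ℤ) (γ : Fin r → ℝ) (k : ℕ) :
    ((‖tp I (nu r) γ‖ ^ (2 * k) : ℝ) : ℂ) =
      ∑ p ∈ tuples k I ×ˢ tuples k I, E (psv r p.1 - psv r p.2) γ := by
  have h1 : ((‖tp I (nu r) γ‖ ^ (2 * k) : ℝ) : ℂ) = (tp I (nu r) γ) ^ k * conj ((tp I (nu r) γ) ^ k) := by
    rw [Complex.mul_conj', norm_pow]; push_cast; ring
  rw [h1, ← VMV.tp_tuples_psv, VMV.conj_tp, VMV.tp_mul]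
  unfold VMV.tp
  refine sum_congr rfl fun p _ => ?_
  congr 1

/-- The real form of (6.14): `|∑_{y ∈ I} e(γ·ν(y))|^{2k} = ‖∑_{(y,y')} e(γ·(s(y) − s(y')))‖`. [cite: Ivic1985, (6.14)] -/
theorem norm_tp_pow_two_mul_eq_norm (I : Finset ℤ) (γ : Fin r → ℝ) (k : ℕ) :
    ‖tp I (nu r) γ‖ ^ (2 * k) = ‖∑ p ∈ tuples k I ×ˢ tuples k I, E (psv r p.1 - psv r p.2) γ‖ := by
  rw [← norm_tp_pow_two_mul_eq, Complex.norm_real, Real.norm_eq_abs, abs_of_nonneg (by positivity)]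

/-! ### Fibres of `(y, y') ↦ s(y) − s(y')` and the box containing all differences -/

/-- The box `Λ = ∏_{m=1}^{r} [−k a^m, k a^m]` of possible differences of power sums. [folklore] -/
theorem psv_sub_mem_box {a k : ℕ} {y y' : Fin k → ℤ} (hy : y ∈ tuples k (Finset.Icc (1 : ℤ) a))
    (hy' : y' ∈ tuples k (Finset.Icc (1 : ℤ) a)) :
    psv r y - psv r y' ∈ Fintype.piFinset fun j : Fin r =>
      Finset.Icc (-((k : ℤ) * (a : ℤ) ^ (j.val + 1))) ((k : ℤ) * (a : ℤ) ^ (j.val + 1)) := by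
  rw [Fintype.mem_piFinset]
  intro j
  rw [VMV.mem_tuples] at hy hy'
  have hbd : ∀ z : Fin k → ℤ, (∀ i, z i ∈ Finset.Icc (1 : ℤ) a) →
      0 ≤ psv r z j ∧ psv r z j ≤ (k : ℤ) * (a : ℤ) ^ (j.val + 1) := by
    intro z hz
    simp only [VMV.psv]
    constructor
    · exact sum_nonneg fun i _ => pow_nonneg (by have := (Finset.mem_Icc.1 (hz i)).1; omega) _
    · calc ∑ i, z i ^ (j.val + 1) ≤ ∑ _i : Fin k, (a : ℤ) ^ (j.val + 1) := by
            refine sum_le_sum fun i _ => ?_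
            have h := Finset.mem_Icc.1 (hz i)
            exact pow_le_pow_left₀ (by omega) h.2 _
        _ = (k : ℤ) * (a : ℤ) ^ (j.val + 1) := by simp
  have h1 := hbd y hy
  have h2 := hbd y' hy'
  rw [Finset.mem_Icc, Pi.sub_apply]
  constructor <;> linarith [h1.1, h1.2, h2.1, h2.2]

/-- Summation over pairs through the fibres of `s(y) − s(y')`:
`∑_{(y,y')} F(s(y) − s(y')) = ∑_{λ ∈ Λ} J_{k,r}(I; λ) F(λ)` for any `Λ` containing all differences.
[cite: Ivic1985, (6.9)–(6.11)] -/
theorem sum_pairs_eq_sum_Jc {M : Type*} [AddCommMonoid M] [Module ℝ M] (k : ℕ) (I : Finset ℤ)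
    {Λ : Finset (Fin r → ℤ)} (hΛ : ∀ y ∈ tuples k I, ∀ y' ∈ tuples k I, psv r y - psv r y' ∈ Λ)
    (F : (Fin r → ℤ) → M) :
    ∑ p ∈ tuples k I ×ˢ tuples k I, F (psv r p.1 - psv r p.2) = ∑ lam ∈ Λ, (Jc r k I lam : ℝ) • F lam := by
  classical
  rw [← sum_fiberwise_of_maps_to (g := fun p : (Fin k → ℤ) × (Fin k → ℤ) => psv r p.1 - psv r p.2)
    (t := Λ) (by intro p hp; rw [mem_product] at hp; exact hΛ _ hp.1 _ hp.2)]
  refine sum_congr rfl fun lam _ => ?_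
  rw [sum_congr rfl (g := fun _ => F lam) (by intro p hp; rw [mem_filter] at hp; rw [hp.2]), sum_const,
    ← Nat.cast_smul_eq_nsmul ℝ]
  congr 2
  unfold VMV.Jc
  congr 1
  refine filter_congr fun p _ => ?_
  constructor
  · intro h; rw [← h]; abel
  · intro h; rw [h]; abel

/-- Hölder in the form used twice: `(∑_{i ∈ s} f i)^{2k} ≤ (#s)^{2k−1} ∑ f_i^{2k}` for `f ≥ 0`, `k ≥ 1`.
[folklore] -/
theorem pow_sum_le_card_pow_mul_sum_pow {ι : Type*} (s : Finset ι) {f : ι → ℝ} (hf : ∀ i ∈ s, 0 ≤ f i)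
    {m : ℕ} (hm : 1 ≤ m) :
    (∑ i ∈ s, f i) ^ m ≤ (s.card : ℝ) ^ (m - 1) * ∑ i ∈ s, f i ^ m := by
  obtain ⟨n, rfl⟩ : ∃ n, m = n + 1 := ⟨m - 1, by omega⟩
  rw [Nat.add_sub_cancel]
  exact pow_sum_le_card_mul_sum_pow hf n

/-! ### The core bound -/

set_option maxHeartbeats 1600000 in
/-- **The Vinogradov–Korobov bound for the bilinear Weyl sum** (Ivić, proof of Theorem 6.2, pp. 121–122):
for real `α₁, …, α_r` (`α j` is the coefficient of `(xy)^{j+1}`), integers `a ≥ 1`, `k ≥ 1`,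

`|∑_{x=1}^{a} ∑_{y=1}^{a} e(∑_{m=1}^{r} α_m x^m y^m)|^{4k²}
   ≤ a^{8k²−4k} · J_{k,r}(a)² · ∏_{m=1}^{r} ∑_{|μ| ≤ ka^m} min(2ka^m + 1, 1/(2‖α_m μ‖))`.
[cite: Ivic1985, Theorem 6.2 (proof)] -/
theorem core_bound (α : Fin r → ℝ) {a k : ℕ} (ha : 1 ≤ a) (hk : 1 ≤ k) :
    ‖∑ x ∈ Finset.Icc (1 : ℤ) a, ∑ y ∈ Finset.Icc (1 : ℤ) a,
        e (∑ j : Fin r, α j * ((x : ℝ) ^ (j.val + 1) * (y : ℝ) ^ (j.val + 1)))‖ ^ (4 * k ^ 2) ≤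
      (a : ℝ) ^ (8 * k ^ 2 - 4 * k) * (J r k (Finset.Icc (1 : ℤ) a) : ℝ) ^ 2 *
        ∏ j : Fin r, ∑ μ ∈ Finset.Icc (-((k : ℤ) * (a : ℤ) ^ (j.val + 1))) ((k : ℤ) * (a : ℤ) ^ (j.val + 1)),
          geomBound (2 * k * (a : ℝ) ^ (j.val + 1) + 1) (α j * μ) := by
  classical
  -- notation
  set I : Finset ℤ := Finset.Icc (1 : ℤ) a with hI
  set P := tuples k I ×ˢ tuples k I with hP
  set Λ : Finset (Fin r → ℤ) := Fintype.piFinset fun j : Fin r =>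
    Finset.Icc (-((k : ℤ) * (a : ℤ) ^ (j.val + 1))) ((k : ℤ) * (a : ℤ) ^ (j.val + 1)) with hΛ
  set Jv : ℝ := (J r k I : ℝ) with hJv
  -- coefficient vectors
  set β : ℤ → Fin r → ℝ := fun x j => α j * (x : ℝ) ^ (j.val + 1) with hβ
  set γ : (Fin r → ℤ) → Fin r → ℝ := fun lam j => α j * (lam j : ℝ) with hγ
  set W : (Fin r → ℤ) → ℝ := fun lam => ‖tp I (nu r) (γ lam)‖ with hWdef
  set gB : Fin r → ℤ → ℝ := fun j μ => geomBound (2 * k * (a : ℝ) ^ (j.val + 1) + 1) (α j * μ) with hgB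
  have hIcard : (I.card : ℝ) = a := by rw [hI, Int.card_Icc]; simp
  have hPcard : (P.card : ℝ) = (a : ℝ) ^ (2 * k) := by
    rw [hP, card_product, VMV.card_tuples, ← pow_add, ← two_mul]; push_cast; rw [hIcard]
  have ha0 : (0 : ℝ) < a := by exact_mod_cast ha
  have hΛmem : ∀ y ∈ tuples k I, ∀ y' ∈ tuples k I, psv r y - psv r y' ∈ Λ := fun y hy y' hy' =>
    psv_sub_mem_box hy hy'
  have hJc_le : ∀ lam, (Jc r k I lam : ℝ) ≤ Jv := fun lam => by
    rw [hJv]; exact_mod_cast VMV.Jc_le_J r k I lam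
  have hJv0 : 0 ≤ Jv := by rw [hJv]; exact Nat.cast_nonneg _
  have hW0 : ∀ lam, 0 ≤ W lam := fun lam => by rw [hWdef]; exact norm_nonneg _
  have hgB0 : ∀ j μ, 0 ≤ gB j μ := fun j μ => by rw [hgB]; exact geomBound_nonneg (by positivity) _
  -- Step 0: the inner sum is `tp I ν (β x)`
  have hinner : ∀ x : ℤ, ∑ y ∈ I, e (∑ j : Fin r, α j * ((x : ℝ) ^ (j.val + 1) * (y : ℝ) ^ (j.val + 1))) =
      tp I (nu r) (β x) := by
    intro x
    unfold VMV.tp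
    refine sum_congr rfl fun y _ => ?_
    rw [VMV.E_eq_e_sum]
    congr 1
    refine sum_congr rfl fun j _ => ?_
    rw [hβ]; simp only [VMV.nu]; push_cast; ring
  -- Step 1: triangle inequality and Hölder in `x`
  have hU_le : ‖∑ x ∈ I, ∑ y ∈ I, e (∑ j : Fin r, α j * ((x : ℝ) ^ (j.val + 1) * (y : ℝ) ^ (j.val + 1)))‖ ≤
      ∑ x ∈ I, ‖tp I (nu r) (β x)‖ := by
    refine (norm_sum_le _ _).trans (le_of_eq ?_)
    exact sum_congr rfl fun x _ => by rw [hinner]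
  have hstep1 : ‖∑ x ∈ I, ∑ y ∈ I, e (∑ j : Fin r, α j * ((x : ℝ) ^ (j.val + 1) * (y : ℝ) ^ (j.val + 1)))‖ ^ (2 * k) ≤
      (a : ℝ) ^ (2 * k - 1) * ∑ x ∈ I, ‖tp I (nu r) (β x)‖ ^ (2 * k) := by
    calc _ ≤ (∑ x ∈ I, ‖tp I (nu r) (β x)‖) ^ (2 * k) := pow_le_pow_left₀ (norm_nonneg _) hU_le _
      _ ≤ (I.card : ℝ) ^ (2 * k - 1) * ∑ x ∈ I, ‖tp I (nu r) (β x)‖ ^ (2 * k) :=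
          pow_sum_le_card_pow_mul_sum_pow I (fun x _ => norm_nonneg _) (by omega)
      _ = _ := by rw [hIcard]
  -- Step 2: (6.14) for each `x`, and `E (λ) (β x) = E (ν x) (γ λ)`-type swap: `∑_x E(λ)(β x) = tp I ν (γ λ)`
  have hswap : ∀ (lam : Fin r → ℤ) (x : ℤ), E lam (β x) = E (nu r x) (γ lam) := by
    intro lam x
    rw [VMV.E_eq_e_sum, VMV.E_eq_e_sum]
    congr 1
    refine sum_congr rfl fun j _ => ?_
    rw [hβ, hγ]; simp only [VMV.nu]; push_cast; ring
  have hstep2 : ∑ x ∈ I, ‖tp I (nu r) (β x)‖ ^ (2 * k) ≤ ∑ p ∈ P, W (psv r p.1 - psv r p.2) := by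
    have hC : ((∑ x ∈ I, ‖tp I (nu r) (β x)‖ ^ (2 * k) : ℝ) : ℂ) =
        ∑ p ∈ P, tp I (nu r) (γ (psv r p.1 - psv r p.2)) := by
      rw [Complex.ofReal_sum]
      simp_rw [norm_tp_pow_two_mul_eq]
      rw [sum_comm]
      refine sum_congr rfl fun p _ => ?_
      unfold VMV.tp
      exact sum_congr rfl fun x _ => hswap _ _
    have hre : ∑ x ∈ I, ‖tp I (nu r) (β x)‖ ^ (2 * k) =
        ‖((∑ x ∈ I, ‖tp I (nu r) (β x)‖ ^ (2 * k) : ℝ) : ℂ)‖ := by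
      rw [Complex.norm_real, Real.norm_eq_abs, abs_of_nonneg (sum_nonneg fun x _ => by positivity)]
    rw [hre, hC]
    exact norm_sum_le _ _
  -- Step 3: Hölder over pairs, then fibres and `Jc ≤ J`
  have hstep3 : (∑ p ∈ P, W (psv r p.1 - psv r p.2)) ^ (2 * k) ≤
      (a : ℝ) ^ (2 * k * (2 * k - 1)) * (Jv * ∑ lam ∈ Λ, W lam ^ (2 * k)) := by
    have h1 := pow_sum_le_card_pow_mul_sum_pow P (f := fun p => W (psv r p.1 - psv r p.2))
      (fun p _ => hW0 _) (m := 2 * k) (by omega)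
    rw [hPcard, ← pow_mul] at h1
    refine h1.trans ?_
    gcongr
    -- `∑_p W(λ_p)^{2k} = ∑_λ Jc(λ) W(λ)^{2k} ≤ J ∑_λ W(λ)^{2k}`
    rw [sum_pairs_eq_sum_Jc k I hΛmem (fun lam => W lam ^ (2 * k)), mul_sum]
    refine sum_le_sum fun lam _ => ?_
    rw [smul_eq_mul]
    exact mul_le_mul_of_nonneg_right (hJc_le lam) (by positivity)
  -- Step 4: `∑_{λ ∈ Λ} W(λ)^{2k} ≤ J ∏_j ∑_μ gB j μ`
  have hstep4 : ∑ lam ∈ Λ, W lam ^ (2 * k) ≤ Jv * ∏ j : Fin r, ∑ μ ∈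
      Finset.Icc (-((k : ℤ) * (a : ℤ) ^ (j.val + 1))) ((k : ℤ) * (a : ℤ) ^ (j.val + 1)), gB j μ := by
    -- (6.14) for `W(λ)^{2k}`, swap the sums, factor the `λ`-sum
    have hC : ((∑ lam ∈ Λ, W lam ^ (2 * k) : ℝ) : ℂ) =
        ∑ q ∈ P, ∏ j : Fin r, ∑ μ ∈ Finset.Icc (-((k : ℤ) * (a : ℤ) ^ (j.val + 1))) ((k : ℤ) * (a : ℤ) ^ (j.val + 1)),
          e ((α j * ((psv r q.1 - psv r q.2) j : ℝ)) * (μ : ℝ)) := by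
      simp only [hWdef]
      rw [Complex.ofReal_sum]
      simp_rw [norm_tp_pow_two_mul_eq]
      rw [sum_comm]
      refine sum_congr rfl fun q _ => ?_
      rw [prod_univ_sum]
      refine sum_congr rfl fun lam _ => ?_
      -- `E μ (γ λ) = ∏_j e((α_j μ_j) λ_j)`
      rw [hγ]; simp only [VMV.E]
      refine prod_congr rfl fun j _ => ?_
      congr 1; ring
    have hre : ∑ lam ∈ Λ, W lam ^ (2 * k) = ‖((∑ lam ∈ Λ, W lam ^ (2 * k) : ℝ) : ℂ)‖ := by
      rw [Complex.norm_real, Real.norm_eq_abs, abs_of_nonneg (sum_nonneg fun x _ => by positivity)]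
    rw [hre, hC]
    -- norms: `‖∏_j S_j‖ ≤ ∏_j gB j μ_j`
    have hq : ∀ q ∈ P, ‖∏ j : Fin r, ∑ μ ∈ Finset.Icc (-((k : ℤ) * (a : ℤ) ^ (j.val + 1))) ((k : ℤ) * (a : ℤ) ^ (j.val + 1)),
          e ((α j * ((psv r q.1 - psv r q.2) j : ℝ)) * (μ : ℝ))‖ ≤ ∏ j : Fin r, gB j ((psv r q.1 - psv r q.2) j) := by
      intro q _
      rw [norm_prod]
      refine prod_le_prod (fun j _ => norm_nonneg _) fun j _ => ?_
      -- Lemma 6.4 on `Icc (-B) B = Ioc (-B-1) (-B-1 + (2B+1))`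
      set B : ℕ := k * a ^ (j.val + 1) with hB
      have hBz : ((k : ℤ) * (a : ℤ) ^ (j.val + 1)) = (B : ℤ) := by rw [hB]; push_cast; ring
      have hIcc : Finset.Icc (-((k : ℤ) * (a : ℤ) ^ (j.val + 1))) ((k : ℤ) * (a : ℤ) ^ (j.val + 1)) =
          Finset.Ioc (-(B : ℤ) - 1) (-(B : ℤ) - 1 + ((2 * B + 1 : ℕ) : ℤ)) := by
        rw [hBz]; ext μ; simp only [Finset.mem_Icc, Finset.mem_Ioc]; push_cast; omega
      rw [hIcc]
      refine (norm_sum_e_mul_le_geomBound _ _ _).trans (le_of_eq ?_)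
      rw [hgB]
      congr 1
      rw [hB]; push_cast; ring
    calc ‖∑ q ∈ P, ∏ j : Fin r, ∑ μ ∈ Finset.Icc (-((k : ℤ) * (a : ℤ) ^ (j.val + 1))) ((k : ℤ) * (a : ℤ) ^ (j.val + 1)),
            e ((α j * ((psv r q.1 - psv r q.2) j : ℝ)) * (μ : ℝ))‖
        ≤ ∑ q ∈ P, ∏ j : Fin r, gB j ((psv r q.1 - psv r q.2) j) := (norm_sum_le _ _).trans (sum_le_sum hq)
      _ = ∑ μv ∈ Λ, (Jc r k I μv : ℝ) • ∏ j : Fin r, gB j (μv j) :=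
          sum_pairs_eq_sum_Jc k I hΛmem (fun μv => ∏ j : Fin r, gB j (μv j))
      _ ≤ ∑ μv ∈ Λ, Jv * ∏ j : Fin r, gB j (μv j) := by
          refine sum_le_sum fun μv _ => ?_
          rw [smul_eq_mul]
          exact mul_le_mul_of_nonneg_right (hJc_le μv) (prod_nonneg fun j _ => hgB0 _ _)
      _ = Jv * ∏ j : Fin r, ∑ μ ∈ Finset.Icc (-((k : ℤ) * (a : ℤ) ^ (j.val + 1))) ((k : ℤ) * (a : ℤ) ^ (j.val + 1)),
            gB j μ := by rw [← mul_sum, prod_univ_sum]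
  -- Assembly
  have hG0 : 0 ≤ ∏ j : Fin r, ∑ μ ∈ Finset.Icc (-((k : ℤ) * (a : ℤ) ^ (j.val + 1))) ((k : ℤ) * (a : ℤ) ^ (j.val + 1)),
      gB j μ := prod_nonneg fun j _ => sum_nonneg fun μ _ => hgB0 _ _
  have hUnn : 0 ≤ ‖∑ x ∈ I, ∑ y ∈ I, e (∑ j : Fin r, α j * ((x : ℝ) ^ (j.val + 1) * (y : ℝ) ^ (j.val + 1)))‖ :=
    norm_nonneg _
  have hsum0 : 0 ≤ ∑ p ∈ P, W (psv r p.1 - psv r p.2) := sum_nonneg fun p _ => hW0 _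
  calc ‖∑ x ∈ I, ∑ y ∈ I, e (∑ j : Fin r, α j * ((x : ℝ) ^ (j.val + 1) * (y : ℝ) ^ (j.val + 1)))‖ ^ (4 * k ^ 2)
      = (‖∑ x ∈ I, ∑ y ∈ I, e (∑ j : Fin r, α j * ((x : ℝ) ^ (j.val + 1) * (y : ℝ) ^ (j.val + 1)))‖ ^ (2 * k)) ^ (2 * k) := by
        rw [← pow_mul]; congr 1; ring
    _ ≤ ((a : ℝ) ^ (2 * k - 1) * ∑ p ∈ P, W (psv r p.1 - psv r p.2)) ^ (2 * k) := by
        gcongr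
        exact hstep1.trans (mul_le_mul_of_nonneg_left hstep2 (by positivity))
    _ = (a : ℝ) ^ ((2 * k - 1) * (2 * k)) * (∑ p ∈ P, W (psv r p.1 - psv r p.2)) ^ (2 * k) := by
        rw [mul_pow, ← pow_mul]
    _ ≤ (a : ℝ) ^ ((2 * k - 1) * (2 * k)) * ((a : ℝ) ^ (2 * k * (2 * k - 1)) * (Jv * (Jv * ∏ j : Fin r, ∑ μ ∈
          Finset.Icc (-((k : ℤ) * (a : ℤ) ^ (j.val + 1))) ((k : ℤ) * (a : ℤ) ^ (j.val + 1)), gB j μ))) := by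
        gcongr
        refine hstep3.trans ?_
        gcongr
    _ = (a : ℝ) ^ (8 * k ^ 2 - 4 * k) * Jv ^ 2 * ∏ j : Fin r, ∑ μ ∈
          Finset.Icc (-((k : ℤ) * (a : ℤ) ^ (j.val + 1))) ((k : ℤ) * (a : ℤ) ^ (j.val + 1)), gB j μ := by
        rw [← mul_assoc, ← pow_add]
        have hexp : (2 * k - 1) * (2 * k) + 2 * k * (2 * k - 1) = 8 * k ^ 2 - 4 * k := by
          zify [show 1 ≤ 2 * k by omega, show 4 * k ≤ 8 * k ^ 2 by nlinarith]
          ring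
        rw [hexp]; ring

end VinogradovZetaSum
end Literature.NumberTheory.LFunctions
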